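import Summits.QuantumFields.YangMills.Theorems.PoincareLipschitzPlanarStreamFunctionL2Letters
import Literature.Analysis.FunctionSpaces.MollificationLp
import Mathlib.MeasureTheory.Function.LpSpace.Complete
import Mathlib.Analysis.SpecificLimits.Basic
import HarnessLib

/-!
# Crux `BlockLipschitzL` (stmt-QuantumFields-23533) ∕ `HistoryTailL` (stmt-QuantumFields-19936), LINE 25 «CompactnessTransfer»,
# the (TM) discharge ROAD (H) «SU(2) currents ⇒ H-system ⇒ 8π quantum», brick (H) — file H7 «THE PLANAR STREAM FUNCTION WITH `L²_loc` VALUES» (row (i′) of ★w3 g16's RULING (α))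

Cell `ym3-torus` (YM ladder rung R3 = continuum SU(2) Yang–Mills on T³ — a RUNG, NOT Clay: not d = 4, not infinite volume,
not a mass gap); WIDTH helper seat `ym3-torus-px5` g9 (brick (H) of px19 g8's road memo `ROAD-TM-HSYSTEM-px19g8.md` §3, released
by ★w3 g15 16:02Z); `--supports stmt-QuantumFields-23533`; THEOREMS ONLY (0 `def`, 0 `sorry`, default heartbeats); imports H3
✓`…PlanarStreamFunctionLimitLetters` (over H1 `…Letters`: mollified rotated field ⇒ `C¹` potential, and H2 `…Cauchy`:
Poincaré–Wirtinger `L¹` estimate on balls), lit ✓`MollificationLp` (`ρ_n ⋆ f → f` in `L^p`), Mathlib (`L^p` completeness letters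
`MeasureTheory.Lp.ae_tendsto_of_cauchy_eLpNorm` ∕ `cauchy_tendsto_of_tendsto` ∕ `memLp_of_cauchy_tendsto`).

WHAT THIS FILE DOES.  ★★★ `exists_streamFunction_sq` — H4's ★★★`exists_streamFunction` WITH THE EXTRA ROW (i′) `LocallyIntegrable ‖B‖²`
(the same construction run at exponent `p = 2`: the Poincaré–Wirtinger estimate is natively `L²`, H6 `…L2Letters`) — for
`A : E² → E²` a.e.-strongly measurable with `∫‖A‖² < ∞` and WEAKLY DIVERGENCE-FREE (`∫ Σ_k ∂_kη·A_k = 0` for all smooth compactly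
supported `η`), there is `B : E² → ℝ` with weak gradient `∇B = A⊥ = (−A₁, A₀)` on all of `E²` in the sense of lit
`Literature.Analysis.FunctionSpaces.HasWeakFDerivOn` — delivered as `GB y = ⟪A⊥ y, ·⟫`, so that `GB y e₀ = −A y 1`, `GB y e₁ = A y 0`
hold at EVERY point and `∫ Σ_k ‖GB e_k‖² = ∫‖A‖² < ∞`.
PROOF.  Mollify (`ρ_n ⋆ A_k → A_k` in `L²`, lit `tendsto_eLpNorm_normed_convolution_sub_self`); by H1 each mollified rotated field has a
`C¹` potential `f_n`, normalised to `∫_{B₁} f_n = 0`; by H2, `‖f_n − f_m‖_{L¹(B_R)} ≤ K_R·(‖ΔM₀‖_{L²} + ‖ΔM₁‖_{L²})`, so along a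
subsequence with `‖ρ_{n_j} ⋆ A_k − A_k‖_{L²} ≤ 2^{−j}` the potentials are `L¹(B_R)`-Cauchy with summable increments for every `R`;
Mathlib's `L^p`-completeness letters give an a.e. and `L¹_loc` limit `B`, and the integration-by-parts identities of the `f_{n_j}`
(lit `HasWeakFDerivOn.of_contDiff_holds`) pass to the limit (`tendsto_integral_of_L1` on both sides).
HONEST SCOPE.  Planar potential theory; (H) is ONE of four bricks (Q)(H)(T)(K) of a road that would trade (TM) [SchoenUhlenbeck1984,
Prop. 1.2] for [BrezisCoron1985, Lemma A.1]; nothing of (TM), (ZD), (C), S1″, K1, `MeanDeviationL`, `BlockLipschitzL`, `HistoryTailL`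
is proved here.  YM₃ on T³ is rung R3, not Clay; YM gap NOT proved; no summit statement is proved here.

References: V. Girault, P.-A. Raviart, Finite Element Methods for Navier–Stokes Equations (1986), Ch. I Thm. 3.1 (stream functions)
[GiraultRaviart1986]; L. C. Evans, Partial Differential Equations (2010), §5.3.1 and §5.8.1 [Evans2010].
-/

set_option autoImplicit false

noncomputable section

open scoped BigOperators Topology ENNReal NNReal Convolution ContDiff InnerProductSpace
open MeasureTheory Set Filter Function TopologicalSpace Metric ContinuousLinearMap

namespace Summit.QuantumFields.YangMills.Theorems.PoincareLipschitzPlanarStreamFunctionL2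

open Literature.Analysis.FunctionSpaces (IsTestFunctionOn HasWeakFDerivOn isTestFunctionOn_normed exists_contDiffBump_seq
  tendsto_eLpNorm_normed_convolution_sub_self)
open Summit.QuantumFields.YangMills.Theorems.PoincareLipschitzPlanarStreamFunctionLetters
open Summit.QuantumFields.YangMills.Theorems.PoincareLipschitzPlanarStreamFunctionLimitLetters
open Summit.QuantumFields.YangMills.Theorems.PoincareLipschitzPlanarStreamFunctionCauchy (eLpNorm_one_le_sqrt_measure_mul_eLpNorm_two)
open Summit.QuantumFields.YangMills.Theorems.PoincareLipschitzPlanarStreamFunctionL2Letters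

/-! ## §5 The stream function -/

/-- ★★★ **THE PLANAR STREAM FUNCTION OF AN `L²` DIVERGENCE-FREE FIELD, WITH `L²_loc` VALUES.**  Let `A : E² → E²` be a.e.-strongly measurable with
`∫ ‖A‖² < ∞`, WEAKLY DIVERGENCE-FREE: `∫ Σ_k ∂_kη·A_k = 0` for every smooth compactly supported `η`.  Then there are `B : E² → ℝ` and
`GB : E² → (E² →L[ℝ] ℝ)` with `HasWeakFDerivOn univ B GB` (lit `SobolevDomain`), `GB y e₀ = −A y 1` and `GB y e₁ = A y 0` for EVERY
`y` (`GB y = ⟪A⊥ y, ·⟫`), `∫ Σ_k ‖GB e_k‖² < ∞`, AND `‖B‖² ∈ L¹_loc` (indeed `B ∈ L²(B_R)` for every `R`) — row (i′).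
[cite: GiraultRaviart1986, Ch. I Thm. 3.1; Evans2010, §5.8.1 Thm. 1] -/
theorem exists_streamFunction_sq
    {A : EuclideanSpace ℝ (Fin 2) → EuclideanSpace ℝ (Fin 2)}
    (hAm : AEStronglyMeasurable A volume)
    (hA2 : Integrable (fun y => ‖A y‖ ^ 2) volume)
    (hdiv : ∀ η : EuclideanSpace ℝ (Fin 2) → ℝ, ContDiff ℝ (⊤ : ℕ∞) η → HasCompactSupport η →
      ∫ y, ∑ k : Fin 2, fderiv ℝ η y (EuclideanSpace.single k (1:ℝ)) * A y k = 0) :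
    ∃ (B : EuclideanSpace ℝ (Fin 2) → ℝ)
      (GB : EuclideanSpace ℝ (Fin 2) → EuclideanSpace ℝ (Fin 2) →L[ℝ] ℝ),
      HasWeakFDerivOn ⟨univ, isOpen_univ⟩ volume B GB ∧
      LocallyIntegrable (fun y => ‖B y‖ ^ 2) volume ∧
      (∀ y, GB y (EuclideanSpace.single 0 (1:ℝ)) = -A y 1 ∧ GB y (EuclideanSpace.single 1 (1:ℝ)) = A y 0) ∧
      Integrable (fun y => ∑ k : Fin 2, ‖GB y (EuclideanSpace.single k (1:ℝ))‖ ^ 2) volume := by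
  -- ───── (a) the components of `A`
  have hAk : ∀ k : Fin 2, MemLp (fun y => A y k) 2 volume := memLp_two_apply hAm hA2
  have hAl : ∀ k : Fin 2, LocallyIntegrable (fun y => A y k) volume := locallyIntegrable_apply hAm hA2
  have hAkm : ∀ k : Fin 2, AEStronglyMeasurable (fun y => A y k) volume := fun k => (hAk k).1
  -- ───── (b) mollifiers and `L²` convergence of the mollified components
  obtain ⟨φ, hφ0, -⟩ := exists_contDiffBump_seq (E := EuclideanSpace ℝ (Fin 2))
  have hρ : ∀ n, IsTestFunctionOn (⊤ : Opens (EuclideanSpace ℝ (Fin 2))) ((φ n).normed volume) :=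
    fun n => isTestFunctionOn_normed (φ n)
  have hM2 : ∀ k : Fin 2, Tendsto (fun n => eLpNorm (((φ n).normed volume ⋆[lsmul ℝ ℝ, volume] fun y => A y k) -
      fun y => A y k) 2 volume) atTop (𝓝 0) :=
    fun k => tendsto_eLpNorm_normed_convolution_sub_self (μ := volume) hφ0 (by norm_num) (by norm_num) (hAk k)
  -- ───── (c) a fast subsequence: `‖ρ_{ψ j} ⋆ A_k − A_k‖₂ ≤ 2^{-j}` for `k = 0, 1`
  have hev : ∀ j : ℕ, ∃ N : ℕ, ∀ n, N ≤ n → ∀ k : Fin 2,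
      eLpNorm (((φ n).normed volume ⋆[lsmul ℝ ℝ, volume] fun y => A y k) - fun y => A y k) 2 volume ≤ (2⁻¹ : ℝ≥0∞) ^ j := by
    intro j
    have hε : (0 : ℝ≥0∞) < (2⁻¹ : ℝ≥0∞) ^ j := ENNReal.pow_pos (ENNReal.inv_pos.2 ENNReal.ofNat_ne_top) j
    obtain ⟨N₀, hN₀⟩ := ENNReal.tendsto_atTop_zero.1 (hM2 0) _ hε
    obtain ⟨N₁, hN₁⟩ := ENNReal.tendsto_atTop_zero.1 (hM2 1) _ hε
    refine ⟨max N₀ N₁, fun n hn k => ?_⟩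
    fin_cases k
    · exact hN₀ n (le_trans (le_max_left _ _) hn)
    · exact hN₁ n (le_trans (le_max_right _ _) hn)
  choose ψ hψ using hev
  have hψk : ∀ j (k : Fin 2), eLpNorm (((φ (ψ j)).normed volume ⋆[lsmul ℝ ℝ, volume] fun y => A y k) - fun y => A y k) 2 volume ≤
      (2⁻¹ : ℝ≥0∞) ^ j := fun j k => hψ j (ψ j) le_rfl k
  -- ───── (d) the potentials of the rotated mollified fields, normalised on the unit ball
  have hex : ∀ j, ∃ f : EuclideanSpace ℝ (Fin 2) → ℝ, ContDiff ℝ 1 f ∧ ∀ a, HasFDerivAt f (innerSL ℝ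
      ((-((φ (ψ j)).normed volume ⋆[lsmul ℝ ℝ, volume] fun y => A y 1) a) • EuclideanSpace.single (0 : Fin 2) (1:ℝ) +
        ((φ (ψ j)).normed volume ⋆[lsmul ℝ ℝ, volume] fun y => A y 0) a • EuclideanSpace.single (1 : Fin 2) (1:ℝ))) a :=
    fun j => exists_potential_mollified_rot hAl hdiv (hρ (ψ j))
  choose f hfC hfD using hex
  set Bs : ℕ → EuclideanSpace ℝ (Fin 2) → ℝ := fun j x => f j x - ⨍ z in ball (0 : EuclideanSpace ℝ (Fin 2)) 1, f j z with hBs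
  have hBsC : ∀ j, ContDiff ℝ 1 (Bs j) := fun j => (hfC j).sub contDiff_const
  have hBsc : ∀ j, Continuous (Bs j) := fun j => (hBsC j).continuous
  have hBsm : ∀ j (μ : Measure (EuclideanSpace ℝ (Fin 2))), AEStronglyMeasurable (Bs j) μ :=
    fun j μ => (hBsc j).aestronglyMeasurable
  have hBsfd : ∀ j x v, fderiv ℝ (Bs j) x v =
      -((φ (ψ j)).normed volume ⋆[lsmul ℝ ℝ, volume] fun y => A y 1) x * v 0 +
        ((φ (ψ j)).normed volume ⋆[lsmul ℝ ℝ, volume] fun y => A y 0) x * v 1 := by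
    intro j x v
    have h1 : fderiv ℝ (Bs j) x = fderiv ℝ (f j) x := by
      show fderiv ℝ (fun x => f j x - ⨍ z in ball (0 : EuclideanSpace ℝ (Fin 2)) 1, f j z) x = fderiv ℝ (f j) x
      exact fderiv_sub_const _
    rw [h1]
    exact (potential_mollified_rot_props hAl (hρ (ψ j)) (hfD j)).1 x v
  -- ───── (e) the Cauchy estimate in `L¹(B_{N+1})`
  have hball : ∀ N : ℕ, (1 : ℝ) ≤ (N : ℝ) + 1 := fun N => by
    have : (0 : ℝ) ≤ N := Nat.cast_nonneg N
    linarith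
  -- the constant `K_N` of H2 at radius `N + 1`, and its finiteness
  have hKfin : ∀ N : ℕ,
      (1 + volume (ball (0 : EuclideanSpace ℝ (Fin 2)) ((N : ℝ) + 1)) ^ (1 / 2 : ℝ) *
          volume (ball (0 : EuclideanSpace ℝ (Fin 2)) 1) ^ (1 / 2 : ℝ) * (volume (ball (0 : EuclideanSpace ℝ (Fin 2)) 1))⁻¹) *
        ENNReal.ofReal (4 * ((N : ℝ) + 1)) ≠ ⊤ := by
    intro N
    have hv10 : volume (ball (0 : EuclideanSpace ℝ (Fin 2)) 1) ≠ 0 := (measure_ball_pos volume _ one_pos).ne'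
    have hvRt : volume (ball (0 : EuclideanSpace ℝ (Fin 2)) ((N : ℝ) + 1)) ≠ ⊤ := measure_ball_lt_top.ne
    have hv1t : volume (ball (0 : EuclideanSpace ℝ (Fin 2)) 1) ≠ ⊤ := measure_ball_lt_top.ne
    refine ENNReal.mul_ne_top ?_ ENNReal.ofReal_ne_top
    exact ENNReal.add_ne_top.2 ⟨ENNReal.one_ne_top, ENNReal.mul_ne_top
      (ENNReal.mul_ne_top (ENNReal.rpow_ne_top_of_nonneg (by norm_num) hvRt) (ENNReal.rpow_ne_top_of_nonneg (by norm_num) hv1t))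
      (ENNReal.inv_ne_top.2 hv10)⟩
  have hcau : ∀ (N n m : ℕ), eLpNorm (Bs n - Bs m) 2 (volume.restrict (ball (0 : EuclideanSpace ℝ (Fin 2)) ((N : ℝ) + 1))) ≤
      (1 + volume (ball (0 : EuclideanSpace ℝ (Fin 2)) ((N : ℝ) + 1)) ^ (1 / 2 : ℝ) *
          volume (ball (0 : EuclideanSpace ℝ (Fin 2)) 1) ^ (1 / 2 : ℝ) * (volume (ball (0 : EuclideanSpace ℝ (Fin 2)) 1))⁻¹) *
        ENNReal.ofReal (4 * ((N : ℝ) + 1)) *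
        ((2⁻¹ : ℝ≥0∞) ^ n + (2⁻¹ : ℝ≥0∞) ^ m + ((2⁻¹ : ℝ≥0∞) ^ n + (2⁻¹ : ℝ≥0∞) ^ m)) := by
    intro N n m
    have h := eLpNorm_two_sub_normalised_potentials_le hAl (hρ (ψ n)) (hρ (ψ m)) (hfD n) (hfD m) (hball N)
    refine h.trans ?_
    gcongr
    · -- `‖M_n0 − M_m0‖₂ ≤ 2^{-n} + 2^{-m}`
      have hc0 : ∀ j, Continuous ((φ (ψ j)).normed volume ⋆[lsmul ℝ ℝ, volume] fun y => A y 0) :=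
        fun j => (contDiff_mollify (hρ (ψ j)) (hAl 0) (n := 0)).continuous
      exact (eLpNorm_sub_le_of_sub (hc0 n).aestronglyMeasurable (hc0 m).aestronglyMeasurable (hAkm 0)).trans
        (add_le_add (hψk n 0) (hψk m 0))
    · have hc1 : ∀ j, Continuous ((φ (ψ j)).normed volume ⋆[lsmul ℝ ℝ, volume] fun y => A y 1) :=
        fun j => (contDiff_mollify (hρ (ψ j)) (hAl 1) (n := 0)).continuous
      exact (eLpNorm_sub_le_of_sub (hc1 n).aestronglyMeasurable (hc1 m).aestronglyMeasurable (hAkm 1)).trans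
        (add_le_add (hψk n 1) (hψk m 1))
  -- the summable majorant `Bd_N j = (4 K_N + 1) 2^{-j}`
  have hhalf : (2⁻¹ : ℝ≥0∞) < 1 := ENNReal.inv_lt_one.2 (by norm_num)
  have hcau' : ∀ (N j n m : ℕ), j ≤ n → j ≤ m →
      eLpNorm (Bs n - Bs m) 2 (volume.restrict (ball (0 : EuclideanSpace ℝ (Fin 2)) ((N : ℝ) + 1))) <
        ((1 + volume (ball (0 : EuclideanSpace ℝ (Fin 2)) ((N : ℝ) + 1)) ^ (1 / 2 : ℝ) *
            volume (ball (0 : EuclideanSpace ℝ (Fin 2)) 1) ^ (1 / 2 : ℝ) * (volume (ball (0 : EuclideanSpace ℝ (Fin 2)) 1))⁻¹) *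
          ENNReal.ofReal (4 * ((N : ℝ) + 1)) * 4 + 1) *
          (2⁻¹ : ℝ≥0∞) ^ j := by
    intro N j n m hjn hjm
    set K := (1 + volume (ball (0 : EuclideanSpace ℝ (Fin 2)) ((N : ℝ) + 1)) ^ (1 / 2 : ℝ) *
          volume (ball (0 : EuclideanSpace ℝ (Fin 2)) 1) ^ (1 / 2 : ℝ) * (volume (ball (0 : EuclideanSpace ℝ (Fin 2)) 1))⁻¹) *
        ENNReal.ofReal (4 * ((N : ℝ) + 1)) with hK
    have hn' : (2⁻¹ : ℝ≥0∞) ^ n ≤ (2⁻¹ : ℝ≥0∞) ^ j := pow_le_pow_right_of_le_one' hhalf.le hjn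
    have hm' : (2⁻¹ : ℝ≥0∞) ^ m ≤ (2⁻¹ : ℝ≥0∞) ^ j := pow_le_pow_right_of_le_one' hhalf.le hjm
    have hpj : (2⁻¹ : ℝ≥0∞) ^ j ≠ 0 := pow_ne_zero _ (by norm_num)
    have hpj' : (2⁻¹ : ℝ≥0∞) ^ j ≠ ⊤ := ENNReal.pow_ne_top (ENNReal.inv_ne_top.2 two_ne_zero)
    calc eLpNorm (Bs n - Bs m) 2 (volume.restrict (ball (0 : EuclideanSpace ℝ (Fin 2)) ((N : ℝ) + 1)))
        ≤ K * ((2⁻¹ : ℝ≥0∞) ^ n + (2⁻¹ : ℝ≥0∞) ^ m + ((2⁻¹ : ℝ≥0∞) ^ n + (2⁻¹ : ℝ≥0∞) ^ m)) := hcau N n m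
      _ ≤ K * ((2⁻¹ : ℝ≥0∞) ^ j + (2⁻¹ : ℝ≥0∞) ^ j + ((2⁻¹ : ℝ≥0∞) ^ j + (2⁻¹ : ℝ≥0∞) ^ j)) := by gcongr
      _ = K * 4 * (2⁻¹ : ℝ≥0∞) ^ j := by ring
      _ < K * 4 * (2⁻¹ : ℝ≥0∞) ^ j + (2⁻¹ : ℝ≥0∞) ^ j :=
          ENNReal.lt_add_right (ENNReal.mul_ne_top (ENNReal.mul_ne_top (hKfin N) (by norm_num)) hpj') hpj
      _ = (K * 4 + 1) * (2⁻¹ : ℝ≥0∞) ^ j := by ring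
  have hBdsum : ∀ N : ℕ, (∑' j : ℕ,
      ((1 + volume (ball (0 : EuclideanSpace ℝ (Fin 2)) ((N : ℝ) + 1)) ^ (1 / 2 : ℝ) *
            volume (ball (0 : EuclideanSpace ℝ (Fin 2)) 1) ^ (1 / 2 : ℝ) * (volume (ball (0 : EuclideanSpace ℝ (Fin 2)) 1))⁻¹) *
          ENNReal.ofReal (4 * ((N : ℝ) + 1)) * 4 + 1) *
        (2⁻¹ : ℝ≥0∞) ^ j) ≠ ⊤ := by
    intro N
    rw [ENNReal.tsum_mul_left, ENNReal.tsum_geometric, ENNReal.one_sub_inv_two, inv_inv]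
    exact ENNReal.mul_ne_top (ENNReal.add_ne_top.2 ⟨ENNReal.mul_ne_top (hKfin N) (by norm_num), ENNReal.one_ne_top⟩)
      ENNReal.ofNat_ne_top
  -- ───── (f) a.e. convergence on every ball, hence on the plane
  have hae_ball : ∀ N : ℕ, ∀ᵐ x ∂(volume.restrict (ball (0 : EuclideanSpace ℝ (Fin 2)) ((N : ℝ) + 1))),
      ∃ l : ℝ, Tendsto (fun j => Bs j x) atTop (𝓝 l) :=
    fun N => MeasureTheory.Lp.ae_tendsto_of_cauchy_eLpNorm (fun j => hBsm j _) one_le_two (hBdsum N)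
      (fun j n m hjn hjm => hcau' N j n m hjn hjm)
  have hae : ∀ᵐ x ∂(volume : Measure (EuclideanSpace ℝ (Fin 2))), ∃ l : ℝ, Tendsto (fun j => Bs j x) atTop (𝓝 l) := by
    have h' : ∀ N : ℕ, ∀ᵐ x ∂(volume : Measure (EuclideanSpace ℝ (Fin 2))),
        x ∈ ball (0 : EuclideanSpace ℝ (Fin 2)) ((N : ℝ) + 1) → ∃ l : ℝ, Tendsto (fun j => Bs j x) atTop (𝓝 l) :=
      fun N => (ae_restrict_iff' measurableSet_ball).1 (hae_ball N)
    rw [← ae_all_iff] at h'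
    filter_upwards [h'] with x hx
    refine hx ⌈‖x‖⌉₊ (mem_ball_zero_iff.2 ?_)
    exact lt_of_le_of_lt (Nat.le_ceil ‖x‖) (by linarith)
  obtain ⟨Blim, hBlim_sm, hBlim⟩ := exists_stronglyMeasurable_limit_of_tendsto_ae (fun j => hBsm j volume) hae
  -- ───── (g) `L²(B_{N+1})` convergence, `L²_loc` values and local integrability of the limit
  have hL2 : ∀ N : ℕ, Tendsto (fun j => eLpNorm (Bs j - Blim) 2 (volume.restrict (ball (0 : EuclideanSpace ℝ (Fin 2)) ((N : ℝ) + 1))))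
      atTop (𝓝 0) :=
    fun N => MeasureTheory.Lp.cauchy_tendsto_of_tendsto (fun j => hBsm j _) Blim (hBdsum N)
      (fun j n m hjn hjm => hcau' N j n m hjn hjm) (ae_restrict_of_ae hBlim)
  have hfin : ∀ N : ℕ, IsFiniteMeasure (volume.restrict (ball (0 : EuclideanSpace ℝ (Fin 2)) ((N : ℝ) + 1))) :=
    fun N => isFiniteMeasure_restrict.2 measure_ball_lt_top.ne
  have hBs2 : ∀ j (N : ℕ), MemLp (Bs j) 2 (volume.restrict (ball (0 : EuclideanSpace ℝ (Fin 2)) ((N : ℝ) + 1))) := by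
    intro j N
    haveI := hfin N
    obtain ⟨C, hC⟩ := (isCompact_closedBall (0 : EuclideanSpace ℝ (Fin 2)) ((N : ℝ) + 1)).exists_bound_of_continuousOn
      (hBsc j).continuousOn
    have htop : MemLp (Bs j) ⊤ (volume.restrict (ball (0 : EuclideanSpace ℝ (Fin 2)) ((N : ℝ) + 1))) :=
      memLp_top_of_bound (hBsm j _) C ((ae_restrict_iff' measurableSet_ball).2 (ae_of_all _ fun x hx =>
        hC x (ball_subset_closedBall hx)))
    exact htop.mono_exponent le_top
  have hBlim_L2 : ∀ N : ℕ, MemLp Blim 2 (volume.restrict (ball (0 : EuclideanSpace ℝ (Fin 2)) ((N : ℝ) + 1))) :=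
    fun N => MeasureTheory.Lp.memLp_of_cauchy_tendsto (p := (2 : ℝ≥0∞)) one_le_two (fun j => hBs2 j N) Blim
      hBlim_sm.aestronglyMeasurable (hL2 N)
  have hBlim_int : ∀ N : ℕ, IntegrableOn Blim (ball (0 : EuclideanSpace ℝ (Fin 2)) ((N : ℝ) + 1)) volume := by
    intro N
    haveI := hfin N
    exact (hBlim_L2 N).integrable one_le_two
  have hBlim_sq : ∀ N : ℕ, IntegrableOn (fun y => ‖Blim y‖ ^ 2) (ball (0 : EuclideanSpace ℝ (Fin 2)) ((N : ℝ) + 1)) volume :=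
    fun N => (memLp_two_iff_integrable_sq_norm hBlim_sm.aestronglyMeasurable.restrict).1 (hBlim_L2 N)
  have hL1 : ∀ N : ℕ, Tendsto (fun j => eLpNorm (Bs j - Blim) 1 (volume.restrict (ball (0 : EuclideanSpace ℝ (Fin 2)) ((N : ℝ) + 1))))
      atTop (𝓝 0) := by
    intro N
    have hup : Tendsto (fun j => eLpNorm (Bs j - Blim) 2 (volume.restrict (ball (0 : EuclideanSpace ℝ (Fin 2)) ((N : ℝ) + 1))) *
        volume (ball (0 : EuclideanSpace ℝ (Fin 2)) ((N : ℝ) + 1)) ^ (1 / 2 : ℝ)) atTop (𝓝 0) := by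
      have hne : volume (ball (0 : EuclideanSpace ℝ (Fin 2)) ((N : ℝ) + 1)) ^ (1 / 2 : ℝ) ≠ ⊤ :=
        ENNReal.rpow_ne_top_of_nonneg (by norm_num) measure_ball_lt_top.ne
      have := ENNReal.Tendsto.mul_const (hL2 N) (Or.inr hne)
      rwa [zero_mul] at this
    refine tendsto_of_tendsto_of_tendsto_of_le_of_le tendsto_const_nhds hup (fun j => zero_le) fun j => ?_
    exact eLpNorm_one_le_sqrt_measure_mul_eLpNorm_two ((hBsc j).aestronglyMeasurable.sub hBlim_sm.aestronglyMeasurable) _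
  have hBlim_loc : LocallyIntegrable Blim volume := by
    intro x
    refine ⟨ball (0 : EuclideanSpace ℝ (Fin 2)) ((⌈‖x‖⌉₊ : ℝ) + 1), isOpen_ball.mem_nhds (mem_ball_zero_iff.2 ?_), hBlim_int _⟩
    exact lt_of_le_of_lt (Nat.le_ceil ‖x‖) (by linarith)
  have hBlim_sq_loc : LocallyIntegrable (fun y => ‖Blim y‖ ^ 2) volume := by
    intro x
    refine ⟨ball (0 : EuclideanSpace ℝ (Fin 2)) ((⌈‖x‖⌉₊ : ℝ) + 1), isOpen_ball.mem_nhds (mem_ball_zero_iff.2 ?_), hBlim_sq _⟩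
    exact lt_of_le_of_lt (Nat.le_ceil ‖x‖) (by linarith)
  -- ───── (h) the weak gradient `GB y = ⟪A⊥ y, ·⟫`
  set GB : EuclideanSpace ℝ (Fin 2) → EuclideanSpace ℝ (Fin 2) →L[ℝ] ℝ := fun y => innerSL ℝ
    ((-(A y 1)) • EuclideanSpace.single (0 : Fin 2) (1:ℝ) + A y 0 • EuclideanSpace.single (1 : Fin 2) (1:ℝ)) with hGB
  have hGBapply : ∀ y v, GB y v = -(A y 1) * v 0 + A y 0 * v 1 := fun y v => by
    rw [hGB]; dsimp only; rw [innerSL_apply_apply, inner_vec2]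
  have hrotm : AEStronglyMeasurable (fun y => (-(A y 1)) • EuclideanSpace.single (0 : Fin 2) (1:ℝ) +
      A y 0 • EuclideanSpace.single (1 : Fin 2) (1:ℝ)) volume := ((hAkm 1).neg.smul_const _).add ((hAkm 0).smul_const _)
  have hGBm : AEStronglyMeasurable GB volume := (innerSL ℝ).continuous.comp_aestronglyMeasurable hrotm
  have hGBnorm : ∀ y, ‖GB y‖ = ‖A y‖ := fun y => by rw [hGB]; dsimp only; rw [innerSL_apply_norm, norm_rot_eq]
  have hGB2 : MemLp GB 2 volume := by
    rw [memLp_two_iff_integrable_sq_norm hGBm]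
    exact hA2.congr (ae_of_all _ fun y => by simp only [hGBnorm])
  -- ───── (i) the integration-by-parts identities of the approximants and their two limits
  have hIBP : ∀ j (η : EuclideanSpace ℝ (Fin 2) → ℝ) (v : EuclideanSpace ℝ (Fin 2)),
      IsTestFunctionOn (⊤ : Opens (EuclideanSpace ℝ (Fin 2))) η →
      ∫ x, fderiv ℝ η x v * Bs j x = -∫ x, η x * (-((φ (ψ j)).normed volume ⋆[lsmul ℝ ℝ, volume] fun y => A y 1) x * v 0 +
        ((φ (ψ j)).normed volume ⋆[lsmul ℝ ℝ, volume] fun y => A y 0) x * v 1) := by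
    intro j η v hη
    have hw := Literature.Analysis.FunctionSpaces.HasWeakFDerivOn.of_contDiff_holds (⊤ : Opens (EuclideanSpace ℝ (Fin 2))) volume
      (hBsC j)
    have key := hw.integral_fderiv_smul_eq η v hη
    simp only [Opens.coe_top, Measure.restrict_univ, smul_eq_mul] at key
    simp_rw [hBsfd j] at key
    exact key
  refine ⟨Blim, GB, ⟨hBlim_loc.locallyIntegrableOn _, (hGB2.locallyIntegrable (by norm_num)).locallyIntegrableOn _, ?_⟩,
    hBlim_sq_loc, fun y => ⟨?_, ?_⟩, ?_⟩
  · -- the weak-derivative identity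
    intro η v hη
    have hηtop : IsTestFunctionOn (⊤ : Opens (EuclideanSpace ℝ (Fin 2))) η := hη.mono le_top
    have hηc : Continuous η := hη.contDiff.continuous
    have hηcs : HasCompactSupport η := hη.hasCompactSupport
    -- a ball `B_{N+1}` containing the support of `η`
    obtain ⟨r, hr⟩ := hηcs.isCompact.isBounded.subset_ball (0 : EuclideanSpace ℝ (Fin 2))
    set N : ℕ := ⌈r⌉₊ with hN
    have hsupp : tsupport η ⊆ ball (0 : EuclideanSpace ℝ (Fin 2)) ((N : ℝ) + 1) :=
      hr.trans (ball_subset_ball (le_trans (Nat.le_ceil r) (by linarith)))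
    -- the weight `g = ∂_v η`: bounded, vanishing off the ball
    have hgc : Continuous fun x => fderiv ℝ η x v := (hη.contDiff.continuous_fderiv (by simp)).clm_apply continuous_const
    have hgs : HasCompactSupport fun x => fderiv ℝ η x v :=
      (hηcs.fderiv ℝ).mono fun x hx => by
        simp only [Function.mem_support, ne_eq] at hx ⊢
        intro h; exact hx (by rw [h, _root_.zero_apply])
    obtain ⟨C, hC⟩ := hgc.bounded_above_of_compact_support hgs
    have hg0 : ∀ x, x ∉ ball (0 : EuclideanSpace ℝ (Fin 2)) ((N : ℝ) + 1) → fderiv ℝ η x v = 0 := by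
      intro x hx
      have hx' : x ∉ tsupport η := fun h => hx (hsupp h)
      have : fderiv ℝ η x = 0 := by
        by_contra hne
        exact hx' (support_fderiv_subset ℝ (Function.mem_support.2 hne))
      rw [this, _root_.zero_apply]
    -- LHS limit
    have hLHS : Tendsto (fun j => ∫ x, fderiv ℝ η x v * Bs j x) atTop (𝓝 (∫ x, fderiv ℝ η x v * Blim x)) :=
      tendsto_integral_mul_of_eLpNorm_restrict measurableSet_ball hC hg0
        (fun j => (hgc.mul (hBsc j)).integrable_of_hasCompactSupport hgs.mul_right)
        (hgc.aestronglyMeasurable.mul hBlim_sm.aestronglyMeasurable) (hL1 N)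
    -- RHS limit: the two mollified components against the `L²` weight `η`
    have hη2 : eLpNorm η 2 volume ≠ ⊤ := (hηc.memLp_of_hasCompactSupport (μ := volume) (p := 2) hηcs).eLpNorm_ne_top
    have hMc : ∀ j (k : Fin 2), Continuous ((φ (ψ j)).normed volume ⋆[lsmul ℝ ℝ, volume] fun y => A y k) :=
      fun j k => (contDiff_mollify (hρ (ψ j)) (hAl k) (n := 0)).continuous
    have hηMi : ∀ j (k : Fin 2), Integrable (fun x => η x * ((φ (ψ j)).normed volume ⋆[lsmul ℝ ℝ, volume] fun y => A y k) x) volume :=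
      fun j k => (hηc.mul (hMc j k)).integrable_of_hasCompactSupport hηcs.mul_right
    have hT : ∀ k : Fin 2, Tendsto (fun j => ∫ x, η x * ((φ (ψ j)).normed volume ⋆[lsmul ℝ ℝ, volume] fun y => A y k) x) atTop
        (𝓝 (∫ x, η x * A x k)) := by
      intro k
      refine tendsto_integral_mul_of_eLpNorm_two hηc.aestronglyMeasurable hη2 (fun j => (hMc j k).aestronglyMeasurable) (hAkm k)
        (fun j => hηMi j k) ?_
      refine tendsto_of_tendsto_of_tendsto_of_le_of_le tendsto_const_nhds (ENNReal.tendsto_pow_atTop_nhds_zero_of_lt_one hhalf)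
        (fun j => zero_le) fun j => hψk j k
    have hηAi : ∀ k : Fin 2, Integrable (fun x => η x * A x k) volume := by
      intro k
      have h := (hAl k).integrable_smul_left_of_hasCompactSupport hηc hηcs
      simpa only [smul_eq_mul] using h
    -- the RHS integrals split
    have hRHSsplit : ∀ j, ∫ x, η x * (-((φ (ψ j)).normed volume ⋆[lsmul ℝ ℝ, volume] fun y => A y 1) x * v 0 +
        ((φ (ψ j)).normed volume ⋆[lsmul ℝ ℝ, volume] fun y => A y 0) x * v 1) =
        -(v 0) * (∫ x, η x * ((φ (ψ j)).normed volume ⋆[lsmul ℝ ℝ, volume] fun y => A y 1) x) +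
          v 1 * (∫ x, η x * ((φ (ψ j)).normed volume ⋆[lsmul ℝ ℝ, volume] fun y => A y 0) x) := by
      intro j
      have hre : ∫ x, η x * (-((φ (ψ j)).normed volume ⋆[lsmul ℝ ℝ, volume] fun y => A y 1) x * v 0 +
          ((φ (ψ j)).normed volume ⋆[lsmul ℝ ℝ, volume] fun y => A y 0) x * v 1) =
          ∫ x, (-(v 0) * (η x * ((φ (ψ j)).normed volume ⋆[lsmul ℝ ℝ, volume] fun y => A y 1) x) +
            v 1 * (η x * ((φ (ψ j)).normed volume ⋆[lsmul ℝ ℝ, volume] fun y => A y 0) x)) :=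
        integral_congr_ae (ae_of_all _ fun x => by ring)
      rw [hre, integral_add ((hηMi j 1).const_mul _) ((hηMi j 0).const_mul _), integral_const_mul, integral_const_mul]
    have hRHSlimsplit : ∫ x, η x * (-(A x 1) * v 0 + A x 0 * v 1) =
        -(v 0) * (∫ x, η x * A x 1) + v 1 * (∫ x, η x * A x 0) := by
      have hre : ∫ x, η x * (-(A x 1) * v 0 + A x 0 * v 1) =
          ∫ x, (-(v 0) * (η x * A x 1) + v 1 * (η x * A x 0)) := integral_congr_ae (ae_of_all _ fun x => by ring)
      rw [hre, integral_add ((hηAi 1).const_mul _) ((hηAi 0).const_mul _), integral_const_mul, integral_const_mul]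
    have hRHS : Tendsto (fun j => ∫ x, η x * (-((φ (ψ j)).normed volume ⋆[lsmul ℝ ℝ, volume] fun y => A y 1) x * v 0 +
        ((φ (ψ j)).normed volume ⋆[lsmul ℝ ℝ, volume] fun y => A y 0) x * v 1)) atTop
        (𝓝 (∫ x, η x * (-(A x 1) * v 0 + A x 0 * v 1))) := by
      simp_rw [hRHSsplit]
      rw [hRHSlimsplit]
      exact ((hT 1).const_mul (-(v 0))).add ((hT 0).const_mul (v 1))
    -- conclude by uniqueness of limits
    have hLHS' : Tendsto (fun j => ∫ x, fderiv ℝ η x v * Bs j x) atTop (𝓝 (-∫ x, η x * (-(A x 1) * v 0 + A x 0 * v 1))) := by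
      have h := hRHS.neg
      refine h.congr fun j => ?_
      exact (hIBP j η v hηtop).symm
    have hfinal := tendsto_nhds_unique hLHS hLHS'
    -- rewrite in the `HasWeakFDerivOn` shape
    show ∫ x in ((⟨univ, isOpen_univ⟩ : Opens (EuclideanSpace ℝ (Fin 2))) : Set (EuclideanSpace ℝ (Fin 2))), fderiv ℝ η x v • Blim x =
      -∫ x in ((⟨univ, isOpen_univ⟩ : Opens (EuclideanSpace ℝ (Fin 2))) : Set (EuclideanSpace ℝ (Fin 2))), η x • GB x v
    simp only [Opens.coe_mk, Measure.restrict_univ, smul_eq_mul, hGBapply]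
    exact hfinal
  · rw [hGBapply]; simp
  · rw [hGBapply]; simp
  · -- `∫ Σ_k ‖GB e_k‖² = ∫ ‖A‖² < ∞`
    refine hA2.congr (ae_of_all _ fun y => ?_)
    show ‖A y‖ ^ 2 = ∑ k : Fin 2, ‖GB y (EuclideanSpace.single k (1:ℝ))‖ ^ 2
    rw [Fin.sum_univ_two, hGBapply, hGBapply, EuclideanSpace.real_norm_sq_eq, Fin.sum_univ_two]
    simp
    ring


end Summit.QuantumFields.YangMills.Theorems.PoincareLipschitzPlanarStreamFunctionL2

end
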